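import Literature.NumberTheory.Automorphic.U21RootMonomials     -- ★ `u21e`, `u21f`, `u21h` = `ρ_ℂ(E₀₁), ρ_ℂ(E₁₀), ρ_ℂ(E₀₀ − E₁₁)` and their three relations
import Mathlib.Algebra.Lie.Sl2                                   -- `IsSl2Triple`
import HarnessLib

/-!
# K2-LIT E1b · 8b-αᵤ road, file 2a «K-TYPE STRINGS»: the `𝔰𝔩₂`-strings of the `𝔨_ℂ`-triple `(h, e, f) = ρ_ℂ(E₀₀ − E₁₁, E₀₁, E₁₀)` of `U(2,1)`

Cell `hodgecm-mathlib`, Track B «K2-LIT» (one theorem-group per file), squad K2, engine E1b (`GKCohomologyU21`, socket 8b-αᵤ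
`sig_K2E1bModelOfRecordCohUnitary`, census `K2/K2-defs1/g3/CENSUS-8b-alpha-ModelOfRecord.K2-defs1-g3.md` row **O5**); seat K2E4-p11 (g2),
deal K2E1b-plan (g4) 2026-09-04T03:49:16Z (c) «file 2».  PROOF-ONLY over ★ `U21RootMonomials` (the triple and its relations
`u21e_mul_u21f_sub`, `u21h_mul_u21e_sub`, `u21h_mul_u21f_sub`) and Mathlib `Algebra/Lie/Sl2`; no `def`, no instance declaration, no notation,
no named fact, no `sorry`.

THE MATHEMATICS ([Kovacevic2021, §3 Def. 1 ∕ Thm. 1, p0005]; [KnappVogan1995, §IV.1]; Mathlib `IsSl2Triple`).  For `(𝔤, K)`-module data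
`ρ𝔤` of `U(2,1)` on `V`, the operators `h = ρ_ℂ(E₀₀ − E₁₁)`, `e = ρ_ℂ(E₀₁)`, `f = ρ_ℂ(E₁₀)` of `𝔨_ℂ = 𝔤𝔩₂ ⊕ 𝔤𝔩₁` satisfy `[e,f] = h`,
`[h,e] = 2e`, `[h,f] = −2f` (★), hence form an `𝔰𝔩₂`-TRIPLE of `End_ℂ V` whenever `h ≠ 0` (§1, Mathlib `IsSl2Triple`).  For a PRIMITIVE vector
`v` (`e v = 0`, `h v = μ v`) the string `f^k v` obeys `h (f^k v) = (μ − 2k) f^k v`, `e (f^{k+1} v) = (k+1)(μ − k) f^k v` (§2 — proved from the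
three relations alone, so they hold with NO `h ≠ 0` proviso), i.e. in Kovačević's normalisation `u^{k+1} := (−f)^k u¹`, `μ = n − 1`:
`H_α u^k = (n+1−2k) u^k`, `Y_α u^k = −u^{k+1}`, `X_α u^{k+1} = −k(n−k) u^k` (§2 `u21_string_kovacevic`).  Inside any finite-dimensional
`f`-stable subspace the string of a primitive `v ≠ 0` terminates: there is a unique `n ≥ 1` with `f^n v = 0 ≠ f^{n−1} v`, and then `μ = n − 1`
(§3) — the K-type through `v` has dimension `n` and `(u^1, …, u^n)` is its adapted basis.

HONEST LABEL: kernel theorems about abstract `(𝔤, K)`-module data of `U(2,1)`; a helper of the 8b-αᵤ road, it closes no socket by itself.  HC_CM is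
proved only modulo the 7 printed citations (2 remaining named inputs: hLiu418 = stmt-HodgeConjecture-24832, h413 = stmt-HodgeConjecture-24833)
until rung 0 closes.

## References
* D. Kovačević, *Unitary representations of SU(2,1) …* (2021), §3 Def. 1, Thm. 1. [Kovacevic2021]
* A. W. Knapp, D. A. Vogan, *Cohomological Induction and Unitary Representations* (1995), §IV.1. [KnappVogan1995]
-/

-- Mathlib idiom (as in ★ `U21RootMonomials` and every `(𝔤, K)` file of the tree): the commutator bracket on `Module.End ℂ V` and on matrices,
-- needed to MENTION `ρ𝔤 : (uFormGroup (Fin 2) (Fin 1)).lie →ₗ⁅ℝ⁆ Module.End ℂ V` (`LieRing.ofAssociativeRing` is a `def` in Mathlib).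
attribute [local instance 100] LieRing.ofAssociativeRing

set_option autoImplicit false
set_option linter.dupNamespace false

noncomputable section

namespace Summit.HodgeConjecture.HodgeConjecture.Cruxes.H413.K2E1bU21KTypeStrings

open Literature.RepresentationTheory Literature.RepresentationTheory.KonnoKonno2007
open Literature.NumberTheory.Automorphic

variable {V : Type*} [AddCommGroup V] [Module ℂ V] (ρ𝔤 : (uFormGroup (Fin 2) (Fin 1)).lie →ₗ⁅ℝ⁆ Module.End ℂ V)

/-! ## §1 The `𝔰𝔩₂`-triple of `𝔨_ℂ` -/

/-- **`(h, e, f) = ρ_ℂ(E₀₀ − E₁₁, E₀₁, E₁₀)` is an `𝔰𝔩₂`-triple of `End_ℂ V`** (Mathlib `IsSl2Triple`, commutator bracket) as soon as `h ≠ 0` — the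
three relations are ★ `u21e_mul_u21f_sub`, `u21h_mul_u21e_sub`, `u21h_mul_u21f_sub`. [cite: KnappVogan1995, §IV.1] -/
theorem isSl2Triple_u21h_u21e_u21f (hh : u21h ρ𝔤 ≠ 0) : IsSl2Triple (u21h ρ𝔤) (u21e ρ𝔤) (u21f ρ𝔤) := by
  refine ⟨hh, ?_, ?_, ?_⟩
  · rw [LieRing.of_associative_ring_bracket]
    exact u21e_mul_u21f_sub ρ𝔤
  · rw [LieRing.of_associative_ring_bracket, u21h_mul_u21e_sub, two_smul, two_nsmul]
  · rw [LieRing.of_associative_ring_bracket, u21h_mul_u21f_sub, two_smul, two_nsmul]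

/-! ## §2 Strings through a primitive vector -/

/-- **`h (f^k v) = (μ − 2k) f^k v`** for `h v = μ v`. [cite: Kovacevic2021, §3 Def. 1] [cite: KnappVogan1995, §IV.1] -/
theorem u21h_apply_u21f_pow_apply {v : V} {μ : ℂ} (hv : u21h ρ𝔤 v = μ • v) (k : ℕ) :
    u21h ρ𝔤 ((u21f ρ𝔤 ^ k) v) = (μ - 2 * k) • (u21f ρ𝔤 ^ k) v := by
  -- `h (f w) = f (h w) − 2 f w`
  have hrel : ∀ w : V, u21h ρ𝔤 (u21f ρ𝔤 w) = u21f ρ𝔤 (u21h ρ𝔤 w) - (2 : ℂ) • u21f ρ𝔤 w := by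
    intro w
    have h1 := congrArg (fun T : Module.End ℂ V => T w) (u21h_mul_u21f_sub ρ𝔤)
    simp only [LinearMap.sub_apply, Module.End.mul_apply, LinearMap.neg_apply, LinearMap.smul_apply] at h1
    rw [sub_eq_iff_eq_add] at h1
    rw [h1]
    abel
  induction k with
  | zero => simp only [pow_zero, Module.End.one_apply, Nat.cast_zero, mul_zero, sub_zero, hv]
  | succ k ih =>
    rw [pow_succ', Module.End.mul_apply, hrel, ih, map_smul, ← sub_smul]
    congr 1
    push_cast
    ring

/-- **`e (f^{k+1} v) = (k+1)(μ − k) f^k v`** for a primitive `v` (`e v = 0`, `h v = μ v`). [cite: Kovacevic2021, §3 Def. 1] [cite: KnappVogan1995, §IV.1] -/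
theorem u21e_apply_u21f_pow_succ_apply {v : V} {μ : ℂ} (hv : u21h ρ𝔤 v = μ • v) (he : u21e ρ𝔤 v = 0) (k : ℕ) :
    u21e ρ𝔤 ((u21f ρ𝔤 ^ (k + 1)) v) = ((k + 1) * (μ - k)) • (u21f ρ𝔤 ^ k) v := by
  -- `e (f w) = f (e w) + h w`
  have hrel : ∀ w : V, u21e ρ𝔤 (u21f ρ𝔤 w) = u21f ρ𝔤 (u21e ρ𝔤 w) + u21h ρ𝔤 w := by
    intro w
    have h1 := congrArg (fun T : Module.End ℂ V => T w) (u21e_mul_u21f_sub ρ𝔤)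
    simp only [LinearMap.sub_apply, Module.End.mul_apply] at h1
    rw [sub_eq_iff_eq_add] at h1
    rw [h1, add_comm]
  induction k with
  | zero =>
    rw [zero_add, pow_one, pow_zero, Module.End.one_apply, hrel, he, map_zero, zero_add, hv]
    congr 1
    push_cast
    ring
  | succ k ih =>
    rw [pow_succ', Module.End.mul_apply, hrel, ih, map_smul, ← Module.End.mul_apply (u21f ρ𝔤), ← pow_succ',
      u21h_apply_u21f_pow_apply ρ𝔤 hv (k + 1), ← add_smul]
    congr 1
    push_cast
    ring

/-- **`h ((−f)^k v) = (μ − 2k) (−f)^k v`** (Kovačević's sign normalisation `u^{k+1} = (−Y_α)^k u¹`). [cite: Kovacevic2021, §3 Def. 1] -/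
theorem u21h_apply_neg_u21f_pow_apply {v : V} {μ : ℂ} (hv : u21h ρ𝔤 v = μ • v) (k : ℕ) :
    u21h ρ𝔤 (((-u21f ρ𝔤) ^ k) v) = (μ - 2 * k) • ((-u21f ρ𝔤) ^ k) v := by
  have hrel : ∀ w : V, u21h ρ𝔤 (u21f ρ𝔤 w) = u21f ρ𝔤 (u21h ρ𝔤 w) - (2 : ℂ) • u21f ρ𝔤 w := by
    intro w
    have h1 := congrArg (fun T : Module.End ℂ V => T w) (u21h_mul_u21f_sub ρ𝔤)
    simp only [LinearMap.sub_apply, Module.End.mul_apply, LinearMap.neg_apply, LinearMap.smul_apply] at h1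
    rw [sub_eq_iff_eq_add] at h1
    rw [h1]
    abel
  induction k with
  | zero => simp only [pow_zero, Module.End.one_apply, Nat.cast_zero, mul_zero, sub_zero, hv]
  | succ k ih =>
    rw [pow_succ', Module.End.mul_apply, LinearMap.neg_apply, map_neg, hrel, ih, map_smul, ← sub_smul, smul_neg]
    congr 2
    push_cast
    ring

/-- **`f ((−f)^k v) = −(−f)^{k+1} v`** (`Y_α u^k = −u^{k+1}`). [cite: Kovacevic2021, §3 Def. 1] -/
theorem u21f_apply_neg_u21f_pow_apply (v : V) (k : ℕ) :
    u21f ρ𝔤 (((-u21f ρ𝔤) ^ k) v) = -(((-u21f ρ𝔤) ^ (k + 1)) v) := by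
  rw [pow_succ', Module.End.mul_apply, LinearMap.neg_apply, neg_neg]

/-- **`e ((−f)^{k+1} v) = −(k+1)(μ − k) (−f)^k v`** for a primitive `v`. [cite: Kovacevic2021, §3 Def. 1] -/
theorem u21e_apply_neg_u21f_pow_succ_apply {v : V} {μ : ℂ} (hv : u21h ρ𝔤 v = μ • v) (he : u21e ρ𝔤 v = 0) (k : ℕ) :
    u21e ρ𝔤 (((-u21f ρ𝔤) ^ (k + 1)) v) = -(((k + 1) * (μ - k)) • ((-u21f ρ𝔤) ^ k) v) := by
  -- `(−f)^k = (−1)^k f^k` on vectors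
  have hsgn : ∀ (k : ℕ) (w : V), ((-u21f ρ𝔤) ^ k) w = ((-1 : ℂ) ^ k) • (u21f ρ𝔤 ^ k) w := by
    intro k w
    induction k with
    | zero => simp only [pow_zero, Module.End.one_apply, one_smul]
    | succ k ih =>
      rw [pow_succ', Module.End.mul_apply, ih, LinearMap.neg_apply, map_smul, pow_succ' (u21f ρ𝔤) k, Module.End.mul_apply,
        pow_succ (-1 : ℂ) k, mul_neg_one, neg_smul]
  rw [hsgn, hsgn, map_smul, u21e_apply_u21f_pow_succ_apply ρ𝔤 hv he k, smul_smul, smul_smul, ← neg_smul, pow_succ]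
  congr 1
  ring

/-- **KOVAČEVIĆ'S ADAPTED STRING** [Kovacevic2021, §3 Def. 1]: for a primitive `u¹ = v` of `h`-weight `n − 1` and `u^{k+1} := (−f)^k u¹`,
`H_α u^{k+1} = (n + 1 − 2(k+1)) u^{k+1}`, `Y_α u^{k+1} = −u^{k+2}`, `X_α u^{k+2} = −(k+1)(n − (k+1)) u^{k+1}`. [cite: Kovacevic2021, §3 Def. 1] -/
theorem u21_string_kovacevic {v : V} {n : ℕ} (hv : u21h ρ𝔤 v = ((n : ℂ) - 1) • v) (he : u21e ρ𝔤 v = 0) (k : ℕ) :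
    u21h ρ𝔤 (((-u21f ρ𝔤) ^ k) v) = ((n : ℂ) + 1 - 2 * (k + 1)) • ((-u21f ρ𝔤) ^ k) v ∧
      u21f ρ𝔤 (((-u21f ρ𝔤) ^ k) v) = -(((-u21f ρ𝔤) ^ (k + 1)) v) ∧
      u21e ρ𝔤 (((-u21f ρ𝔤) ^ (k + 1)) v) = -(((k + 1 : ℂ) * (n - (k + 1))) • ((-u21f ρ𝔤) ^ k) v) := by
  refine ⟨?_, u21f_apply_neg_u21f_pow_apply ρ𝔤 v k, ?_⟩
  · rw [u21h_apply_neg_u21f_pow_apply ρ𝔤 hv k]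
    congr 1
    ring
  · rw [u21e_apply_neg_u21f_pow_succ_apply ρ𝔤 hv he k]
    congr 2
    ring

/-! ## §3 Strings terminate in finite dimension, and the weight is `n − 1` -/

/-- **The weight of a terminating string**: if `e v = 0`, `h v = μ v`, `f^n v = 0` and `f^{n−1} v ≠ 0` then `μ = n − 1`. [cite: Kovacevic2021, §3 Def. 1] [cite: KnappVogan1995, §IV.1] -/
theorem eq_natCast_sub_one_of_u21f_pow_apply_eq_zero {v : V} {μ : ℂ} (hv : u21h ρ𝔤 v = μ • v) (he : u21e ρ𝔤 v = 0) {n : ℕ}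
    (hn : (u21f ρ𝔤 ^ n) v = 0) (hn' : (u21f ρ𝔤 ^ (n - 1)) v ≠ 0) : μ = (n : ℂ) - 1 := by
  cases n with
  | zero => exact absurd (by simpa only [pow_zero, Module.End.one_apply] using hn) (by simpa only [Nat.zero_sub, pow_zero, Module.End.one_apply] using hn')
  | succ m =>
    have h1 := u21e_apply_u21f_pow_succ_apply ρ𝔤 hv he m
    rw [hn, map_zero] at h1
    have h2 : ((m : ℂ) + 1) * (μ - m) = 0 :=
      (smul_eq_zero.mp h1.symm).resolve_right (by simpa only [Nat.add_sub_cancel] using hn')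
    have h3 : (m : ℂ) + 1 ≠ 0 := by exact_mod_cast Nat.succ_ne_zero m
    have h4 : μ - m = 0 := (mul_eq_zero.mp h2).resolve_left h3
    rw [sub_eq_zero] at h4
    rw [h4]
    push_cast
    ring

/-- **Strings terminate inside a finite-dimensional `f`-stable subspace**: the `f^k v` are `h`-eigenvectors of the distinct weights `μ − 2k`,
so some `f^n v` vanishes. [cite: KnappVogan1995, §IV.1] -/
theorem exists_u21f_pow_apply_eq_zero {U : Submodule ℂ V} [FiniteDimensional ℂ U] (hU : ∀ u ∈ U, u21f ρ𝔤 u ∈ U)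
    {v : V} (hvU : v ∈ U) {μ : ℂ} (hv : u21h ρ𝔤 v = μ • v) : ∃ n : ℕ, (u21f ρ𝔤 ^ n) v = 0 := by
  by_contra hne
  push Not at hne
  -- the string stays in `U`
  have hmem : ∀ n : ℕ, (u21f ρ𝔤 ^ n) v ∈ U := by
    intro n
    induction n with
    | zero => simpa only [pow_zero, Module.End.one_apply] using hvU
    | succ n ih =>
      rw [pow_succ', Module.End.mul_apply]
      exact hU _ ih
  -- `finrank U + 1` eigenvectors of `h` with distinct weights `μ − 2k`, all in `U`
  set N := Module.finrank ℂ U with hN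
  let g : Fin (N + 1) → ↥U := fun i => ⟨(u21f ρ𝔤 ^ (i : ℕ)) v, hmem i⟩
  have hind : LinearIndependent ℂ g := by
    refine LinearIndependent.of_comp U.subtype ?_
    refine Module.End.eigenvectors_linearIndependent' (u21h ρ𝔤) (fun i : Fin (N + 1) => μ - 2 * ((i : ℕ) : ℂ)) ?_ _ ?_
    · intro i j hij
      have h2 : ((i : ℕ) : ℂ) = ((j : ℕ) : ℂ) := by
        have := hij
        simp only [sub_right_inj, mul_eq_mul_left_iff, OfNat.ofNat_ne_zero, or_false] at this
        exact this
      exact Fin.ext (by exact_mod_cast h2)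
    · intro i
      exact Module.End.hasEigenvector_iff.mpr ⟨Module.End.mem_eigenspace_iff.mpr (u21h_apply_u21f_pow_apply ρ𝔤 hv i), hne i⟩
  have hcard := hind.fintype_card_le_finrank
  rw [Fintype.card_fin] at hcard
  omega

/-- **THE STRING OF A PRIMITIVE VECTOR IN A FINITE-DIMENSIONAL `f`-STABLE SUBSPACE** (the K-type through `v`): there is a unique length
`n ≥ 1` with `f^n v = 0`, `f^k v ≠ 0` (`k < n`), and the weight is `μ = n − 1` — so `v = u¹, (−f)v = u², …, (−f)^{n−1} v = u^n` is Kovačević's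
adapted basis of an `n`-dimensional K-type. [cite: Kovacevic2021, §3 Def. 1] [cite: KnappVogan1995, §IV.1] -/
theorem exists_string_length {U : Submodule ℂ V} [FiniteDimensional ℂ U] (hU : ∀ u ∈ U, u21f ρ𝔤 u ∈ U)
    {v : V} (hvU : v ∈ U) (hv0 : v ≠ 0) {μ : ℂ} (hv : u21h ρ𝔤 v = μ • v) (he : u21e ρ𝔤 v = 0) :
    ∃ n : ℕ, 0 < n ∧ μ = (n : ℂ) - 1 ∧ (u21f ρ𝔤 ^ n) v = 0 ∧ ∀ k < n, (u21f ρ𝔤 ^ k) v ≠ 0 := by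
  classical
  have hex : ∃ n : ℕ, (u21f ρ𝔤 ^ n) v = 0 := exists_u21f_pow_apply_eq_zero ρ𝔤 hU hvU hv
  refine ⟨Nat.find hex, ?_, ?_, Nat.find_spec hex, fun k hk => Nat.find_min hex hk⟩
  · rw [Nat.pos_iff_ne_zero]
    intro h0
    have h1 := Nat.find_spec hex
    rw [h0, pow_zero, Module.End.one_apply] at h1
    exact hv0 h1
  · refine eq_natCast_sub_one_of_u21f_pow_apply_eq_zero ρ𝔤 hv he (Nat.find_spec hex) ?_
    have hpos : 0 < Nat.find hex := by
      rw [Nat.pos_iff_ne_zero]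
      intro h0
      have h1 := Nat.find_spec hex
      rw [h0, pow_zero, Module.End.one_apply] at h1
      exact hv0 h1
    exact Nat.find_min hex (Nat.sub_lt hpos Nat.one_pos)

end Summit.HodgeConjecture.HodgeConjecture.Cruxes.H413.K2E1bU21KTypeStrings

end
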